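import Summits.BirchSwinnertonDyer.BirchSwinnertonDyer.Theorems.SmallImageMuTransferMuTransferX9CentralScalar
import Literature.NumberTheory.EllipticCurves.ModPImageScalarThreeProofs
import HarnessLib

/-!
# K6 crux `MuTransferX9` (stmt-BirchSwinnertonDyer-19276): MU-TRANSFER-PROOF (F8) Sah bridge on the
# genuine `𝒯_J(E)` — the FIELD-AGNOSTIC core (central scalar as a hypothesis) and the form at every
# ODD prime over `ℚ` (class X10b∧¬Surj at `p = 3` included) — KERNEL

HONEST FRAMING (cell `b2b-bsdres`, X9 prover lineage; verbatim): the cell deletes COMBINATION-SHAPED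
residual classes of the rank-≤1 BSD formula from PUBLISHED theorems only and TYPES the
construction-shaped remainder; this is not "finishing BSD".  Theorems only (no definition, no named
fact, no `sorry`); nothing is asserted about any curve beyond what the kernel proves; class X9 stays
TYPED at class level; no pair, count, mark or tier word moves.  Helper file
(`--supports stmt-BirchSwinnertonDyer-19276 --as helper`): it closes no stub and no item.

Sequel of `SmallImageMuTransferMuTransferX9CentralScalar` (X9 prover GEN 42, p438891), same session.
That file instantiates Sah's lemma relative to `G_{L₀}` on `𝒯_J(E) = W.modPTwist p κ J` over `ℚ` for
`p ≥ 5` (the tree's scalar lemma `exists_galoisRepTorsion_eq_smul_of_not_surjective` is stated for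
`p ≥ 5`).  Here:

* §1 the FIELD-AGNOSTIC core: over ANY field `F` and any `κ : ZpExtension F p`, GIVEN `σ₀ ∈ ker κ`
  acting on `E[p]` as a scalar `a ≠ 1`, two continuous 1-cocycles of `Γ_F` in `𝒯_J(E)` (resp. in the
  `κ⁻¹`-twist) agreeing on `ker ρ̄_{E,p} ⊓ ker κ` have the same class
  (`modPTwist_oneCocycleClass_eq_of_forall_mem_eq_of_smul_eq`, vanishing and `invTwist` forms) — so
  the bridge ports to any base field where such a scalar is known;
* §2 over `ℚ` at every ODD prime: `p ≠ 2`, `E[p]` irreducible, `ρ̄_{E,p}` not onto ⟹ the central scalar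
  inside `Gal(ℚ̄/ℚ_∞)` exists (`exists_mem_kerSubgroup_smul_eq_of_ne_two`: `p ≥ 5` from the prequel,
  `p = 3` — class X10b∧¬Surj, images 3Ns/3Nn, `a = −1` — from the tree's
  `exists_galoisRepTorsion_eq_smul_of_not_surjective_three`, seat koly p428450, MU-TRANSFER-PROOF
  §7 (ii)), hence the Sah bridge at every odd prime (`…_of_ne_two` forms).  At `p = 2` an irreducible
  proper image is `C₃ ⊂ GL₂(𝔽₂)` and contains no scalar `≠ 1`: `p ≠ 2` is the natural hypothesis.

References: C.-H. Sah, J. Algebra 10 (1968) Prop. 2.7 (b); J.-P. Serre, Invent. Math. 15 (1972) §2.4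
Prop. 15, §2.6; L. C. Washington, GTM 83, §13.1; `HOME/koly/MU-TRANSFER-PROOF.md` §1 (F8), §7 (ii).
(X9 prover GEN 42, 2026-08-26.)
-/

-- the summit and its single problem are both named `BirchSwinnertonDyer` (registry layout D-0017)
set_option linter.dupNamespace false

set_option autoImplicit false

noncomputable section

open Field WeierstrassCurve Literature.NumberTheory.EllipticCurves
  Literature.NumberTheory.GaloisRepresentations Function

namespace Summit.BirchSwinnertonDyer.BirchSwinnertonDyer.Rank1Residual

/-! ### §1 The field-agnostic core: the central scalar as a hypothesis -/

section Core

universe u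

variable {F : Type u} [Field F] (W : WeierstrassCurve F) (p : ℕ) [Fact p.Prime]
  (κ : ZpExtension F p)

/-- **Sah on the genuine `𝒯_J(E)`, field-agnostic core.** Over ANY field `F`: GIVEN `σ₀ ∈ ker κ`
acting on `E[p]` as a scalar `a ≠ 1`, two continuous 1-cocycles of `Γ_F` with values in
`𝒯_J(E) = W.modPTwist p κ J` that agree on `ker ρ̄_{E,p} ⊓ ker κ` have the same class in
`H¹(F, 𝒯_J(E))` (relative Sah `SahRel.oneCocycleClass_eq_of_forall_mem_eq` with `z = σ₀`: central
modulo `ker ρ̄ ⊓ ker κ`, acting as `a`, which commutes with `Γ_F` and has `a − 1` invertible).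
[cite: Sah1968, Prop. 2.7 (b) and its proof, p. 60] [cite: Serre1972, §2.6] -/
theorem modPTwist_oneCocycleClass_eq_of_forall_mem_eq_of_smul_eq {σ₀ : absoluteGaloisGroup F}
    {a : ZMod p} (ha : a ≠ 1) (hκ : σ₀ ∈ κ.kerSubgroup)
    (hσ₀ : ∀ P : geomTorsion W p, σ₀ • P = a.val • P) (J : ℕ)
    (φ ψ : contOneCocycles (W.modPTwist p κ J).toTopRep)
    (hN : ∀ ν ∈ (galoisRepTorsion W p).ker ⊓ κ.kerSubgroup, φ.1 ν = ψ.1 ν) :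
    oneCocycleClass _ φ = oneCocycleClass _ ψ := by
  have hρσ₀ : ∀ x : (W.modPTwist p κ J).toTopRep,
      (W.modPTwist p κ J).toTopRep.ρ σ₀ x = a.val • x :=
    fun x => modPTwist_eq_smul_of_mem_kerSubgroup p W κ J hσ₀ hκ x
  refine SahRel.oneCocycleClass_eq_of_forall_mem_eq φ ψ _ hN
    (exists_mem_inf_mul_eq_of_smul_eq W p κ hσ₀ hκ) (fun g x => ?_) ?_
  · rw [hρσ₀, hρσ₀, map_nsmul]
  · have : (fun x : (W.modPTwist p κ J).toTopRep => (W.modPTwist p κ J).toTopRep.ρ σ₀ x - x) =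
        fun x : Fin J → geomTorsion W p => a.val • x - x := by
      funext x
      rw [hρσ₀]
    rw [this]
    exact bijective_smul_sub_self p W J ha

/-- Field-agnostic core, vanishing form: given the central scalar `σ₀ ∈ ker κ`, a continuous
1-cocycle of `Γ_F` in `𝒯_J(E)` vanishing on `ker ρ̄_{E,p} ⊓ ker κ` is a coboundary.
[cite: Sah1968, Prop. 2.7 (b) and its proof, p. 60] [cite: Serre1972, §2.6] -/
theorem modPTwist_oneCocycleClass_eq_zero_of_forall_mem_eq_zero_of_smul_eq
    {σ₀ : absoluteGaloisGroup F} {a : ZMod p} (ha : a ≠ 1) (hκ : σ₀ ∈ κ.kerSubgroup)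
    (hσ₀ : ∀ P : geomTorsion W p, σ₀ • P = a.val • P) (J : ℕ)
    (φ : contOneCocycles (W.modPTwist p κ J).toTopRep)
    (hN : ∀ ν ∈ (galoisRepTorsion W p).ker ⊓ κ.kerSubgroup, φ.1 ν = 0) :
    oneCocycleClass _ φ = 0 := by
  rw [← oneCocycleClass_zero (W.modPTwist p κ J).toTopRep]
  exact modPTwist_oneCocycleClass_eq_of_forall_mem_eq_of_smul_eq W p κ ha hκ hσ₀ J φ 0
    (fun ν hν => by rw [hN ν hν]; rfl)

/-- Field-agnostic core, dual side: the same for the `κ⁻¹`-twist `W.modPTwist p κ.invTwist J`, with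
the SAME subgroup `ker ρ̄_{E,p} ⊓ ker κ` and the same `σ₀` (`ker κ⁻¹ = ker κ`).
[cite: Sah1968, Prop. 2.7 (b) and its proof, p. 60] [cite: Serre1972, §2.6] -/
theorem invTwist_modPTwist_oneCocycleClass_eq_of_forall_mem_eq_of_smul_eq
    {σ₀ : absoluteGaloisGroup F} {a : ZMod p} (ha : a ≠ 1) (hκ : σ₀ ∈ κ.kerSubgroup)
    (hσ₀ : ∀ P : geomTorsion W p, σ₀ • P = a.val • P) (J : ℕ)
    (φ ψ : contOneCocycles (W.modPTwist p κ.invTwist J).toTopRep)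
    (hN : ∀ ν ∈ (galoisRepTorsion W p).ker ⊓ κ.kerSubgroup, φ.1 ν = ψ.1 ν) :
    oneCocycleClass _ φ = oneCocycleClass _ ψ := by
  have hκ' : σ₀ ∈ κ.invTwist.kerSubgroup := by
    rw [ZpExtension.kerSubgroup_unitTwist]
    exact hκ
  refine modPTwist_oneCocycleClass_eq_of_forall_mem_eq_of_smul_eq W p κ.invTwist ha hκ' hσ₀ J φ ψ
    ?_
  rw [ZpExtension.kerSubgroup_unitTwist]
  exact hN

end Core

/-! ### §2 Over `ℚ` at every ODD prime (`p = 3`: class X10b∧¬Surj) -/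

section RatOdd

variable (W : WeierstrassCurve ℚ) [W.IsElliptic] (p : ℕ) [Fact p.Prime] (κ : ZpExtension ℚ p)

/-- **The central scalar inside `Gal(ℚ̄/ℚ_∞)` at every ODD prime**: for `E/ℚ`, `p ≠ 2`, `E[p]`
irreducible and `ρ̄_{E,p}` not onto, some `σ₀ ∈ ker κ` acts on `E[p]` as a scalar `a ≠ 1` — `p ≥ 5`
by `exists_mem_kerSubgroup_smul_eq` (prequel), `p = 3` (class X10b∧¬Surj, images 3Ns/3Nn, `a = −1`)
by the tree's `exists_galoisRepTorsion_eq_smul_of_not_surjective_three` moved into `ker κ` along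
GEN 41's joint surjectivity (p434740). [cite: Serre1972, §2.4 Prop. 15 and §2.6]
[cite: Washington1997, §13.1] -/
theorem exists_mem_kerSubgroup_smul_eq_of_ne_two (hp2 : p ≠ 2)
    (hirr : W.HasIrreducibleModPGaloisRep p) (hns : ¬ W.HasSurjectiveModNGaloisRep p) :
    ∃ (σ₀ : absoluteGaloisGroup ℚ) (a : ZMod p), a ≠ 1 ∧ σ₀ ∈ κ.kerSubgroup ∧
      ∀ P : geomTorsion W p, σ₀ • P = a.val • P := by
  by_cases hp3 : p = 3
  · obtain ⟨σ, a, ha1, hσ⟩ :=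
      exists_galoisRepTorsion_eq_smul_of_not_surjective_three W p hp3 hirr hns
    obtain ⟨σ₀, hρ, hκ⟩ :=
      exists_galoisRepTorsion_eq_and_eq_of_irreducible_of_not_surjective W p κ hirr hns σ 1
    refine ⟨σ₀, a, ha1, ZpExtension.mem_kerSubgroup.mpr hκ, fun P => ?_⟩
    rw [← galoisRepTorsion_apply, hρ]
    exact hσ P
  · exact exists_mem_kerSubgroup_smul_eq W p κ
      ((Fact.out : p.Prime).five_le_of_ne_two_of_ne_three hp2 hp3) hirr hns

/-- **Sah on the genuine `𝒯_J(E)` at every ODD prime** (`p ≠ 2`, `E[p]` irreducible, `ρ̄_{E,p}` not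
onto — class X9 at `p ≥ 5`, class X10b∧¬Surj at `p = 3`): two continuous 1-cocycles of `Γ_ℚ` in
`W.modPTwist p κ J` agreeing on `ker ρ̄_{E,p} ⊓ ker κ` have the same class.
[cite: Sah1968, Prop. 2.7 (b) and its proof, p. 60] [cite: Serre1972, §2.4 Prop. 15 and §2.6] -/
theorem modPTwist_oneCocycleClass_eq_of_forall_mem_eq_of_ne_two (hp2 : p ≠ 2)
    (hirr : W.HasIrreducibleModPGaloisRep p) (hns : ¬ W.HasSurjectiveModNGaloisRep p) (J : ℕ)
    (φ ψ : contOneCocycles (W.modPTwist p κ J).toTopRep)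
    (hN : ∀ ν ∈ (galoisRepTorsion W p).ker ⊓ κ.kerSubgroup, φ.1 ν = ψ.1 ν) :
    oneCocycleClass _ φ = oneCocycleClass _ ψ := by
  obtain ⟨σ₀, a, ha1, hκ, hσ₀⟩ := exists_mem_kerSubgroup_smul_eq_of_ne_two W p κ hp2 hirr hns
  exact modPTwist_oneCocycleClass_eq_of_forall_mem_eq_of_smul_eq W p κ ha1 hκ hσ₀ J φ ψ hN

/-- Vanishing form at every odd prime: a continuous 1-cocycle of `Γ_ℚ` in `𝒯_J(E)` vanishing on
`ker ρ̄_{E,p} ⊓ ker κ` is a coboundary. [cite: Sah1968, Prop. 2.7 (b) and its proof, p. 60]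
[cite: Serre1972, §2.4 Prop. 15 and §2.6] -/
theorem modPTwist_oneCocycleClass_eq_zero_of_forall_mem_eq_zero_of_ne_two (hp2 : p ≠ 2)
    (hirr : W.HasIrreducibleModPGaloisRep p) (hns : ¬ W.HasSurjectiveModNGaloisRep p) (J : ℕ)
    (φ : contOneCocycles (W.modPTwist p κ J).toTopRep)
    (hN : ∀ ν ∈ (galoisRepTorsion W p).ker ⊓ κ.kerSubgroup, φ.1 ν = 0) :
    oneCocycleClass _ φ = 0 := by
  obtain ⟨σ₀, a, ha1, hκ, hσ₀⟩ := exists_mem_kerSubgroup_smul_eq_of_ne_two W p κ hp2 hirr hns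
  exact modPTwist_oneCocycleClass_eq_zero_of_forall_mem_eq_zero_of_smul_eq W p κ ha1 hκ hσ₀ J φ hN

/-- The literal (F8) reading at every odd prime: agreement on `G_{L₀} = ker ρ̄_{E,p} ⊓ Gal(ℚ̄/ℚ_n)`
(`⊇ ker ρ̄ ⊓ ker κ`) suffices, at every layer `n` and level `J`.
[cite: Sah1968, Prop. 2.7 (b) and its proof, p. 60] [cite: Serre1972, §2.4 Prop. 15 and §2.6] -/
theorem modPTwist_oneCocycleClass_eq_of_forall_mem_layerSubgroup_eq_of_ne_two (hp2 : p ≠ 2)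
    (hirr : W.HasIrreducibleModPGaloisRep p) (hns : ¬ W.HasSurjectiveModNGaloisRep p) (J n : ℕ)
    (φ ψ : contOneCocycles (W.modPTwist p κ J).toTopRep)
    (hN : ∀ ν ∈ (galoisRepTorsion W p).ker ⊓ κ.layerSubgroup n, φ.1 ν = ψ.1 ν) :
    oneCocycleClass _ φ = oneCocycleClass _ ψ :=
  modPTwist_oneCocycleClass_eq_of_forall_mem_eq_of_ne_two W p κ hp2 hirr hns J φ ψ fun ν hν =>
    hN ν (Subgroup.mem_inf.mpr
      ⟨(Subgroup.mem_inf.mp hν).1, κ.kerSubgroup_le_layerSubgroup n (Subgroup.mem_inf.mp hν).2⟩)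

/-- Dual side at every odd prime: the same for `W.modPTwist p κ.invTwist J`, same subgroup.
[cite: Sah1968, Prop. 2.7 (b) and its proof, p. 60] [cite: Serre1972, §2.4 Prop. 15 and §2.6] -/
theorem invTwist_modPTwist_oneCocycleClass_eq_of_forall_mem_eq_of_ne_two (hp2 : p ≠ 2)
    (hirr : W.HasIrreducibleModPGaloisRep p) (hns : ¬ W.HasSurjectiveModNGaloisRep p) (J : ℕ)
    (φ ψ : contOneCocycles (W.modPTwist p κ.invTwist J).toTopRep)
    (hN : ∀ ν ∈ (galoisRepTorsion W p).ker ⊓ κ.kerSubgroup, φ.1 ν = ψ.1 ν) :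
    oneCocycleClass _ φ = oneCocycleClass _ ψ := by
  obtain ⟨σ₀, a, ha1, hκ, hσ₀⟩ := exists_mem_kerSubgroup_smul_eq_of_ne_two W p κ hp2 hirr hns
  exact invTwist_modPTwist_oneCocycleClass_eq_of_forall_mem_eq_of_smul_eq W p κ ha1 hκ hσ₀ J φ ψ hN

end RatOdd

end Summit.BirchSwinnertonDyer.BirchSwinnertonDyer.Rank1Residual

end
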